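import Mathlib
import HarnessLib
import Summits.FinalStateConjecture.FinalStateConjecture.Theses.StarvedNecks
import Literature.Geometry.Lorentzian.CausalityPushUp
import Literature.Geometry.Lorentzian.CausalFutureProofs
import Literature.Geometry.Lorentzian.MinkowskiGlobalHyperbolicity

/-!
# Sketch — crux-ideate stmt-FinalStateConjecture-13551 (StarvedNecks.SeamedChartsExhaust), ideator 3

First lemmas of the two idea cards `open-late-region-first-entry` (COVER half) and
`anchor-and-board` (REACH half), plus PROOFS of the causal-topological glue:
`firstEntryCovering_holds` (abstract first-entry lemma), `certifiedLateIsOpen_holds` (the certified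
late region is open — lateral walls are flat-late), `exteriorOf_causallyConvex`, `lineCloses_holds`,
`holeAnchoring_holds`, and the net reductions `seamedChartsExhaust_of` /
`seamedChartsExhaust_of₂ : FrontierBelowSlab → ChartedReach → StarvedNecks.SeamedChartsExhaust`.
rc 0, no `sorry`, axioms {propext, Classical.choice, Quot.sound}.
`Hc` / `Sm` are verbatim copies of the `let`-bound predicates of the route decl
`Summit.FinalStateConjecture.FinalStateConjecture.Theses.StarvedNecks.SeamedChartsExhaust`
(`seamedChartsExhaust_iff := Iff.rfl`).
-/

noncomputable section

namespace Summit.FinalStateConjecture.FinalStateConjecture.Cruxes.SeamedChartsExhaust.Sketch3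

open scoped BigOperators Topology Manifold Classical ContDiff ENNReal
open Filter Set Function TopologicalSpace
open Literature.Geometry.Lorentzian

/-- HonestCore(d, R₀) — copy of the `Hc` of the route decl. -/
def Hc (𝓢 : Spacetime.{0} 4) (O : Set 𝓢.carrier) (k : ℕ) (d : FinalStateDecomposition 𝓢 O k)
    (R₀ : ℝ) : Prop :=
  let B := d.background; let t := fun i ↦ (B i).time; let r := fun i ↦ (B i).radius; let Ψ := d.chart;
  (∀ i, Kerr.IsSubextremal (d.mass i) (d.spin i) ∧ 100 * d.mass i ≤ R₀ ∧
      0 < ((d.motion i).1 : E4 ≃L[ℝ] E4) (E4.basisVector 0) 0) ∧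
  (∀ i (ϱ τ₂ : ℝ), R₀ ≤ ϱ → d.τ₀ < τ₂ →
      Ψ i '' {x | d.τ₀ < t i x.1 ∧ t i x.1 < τ₂ ∧ r i x.1 < ϱ} ⊆
        𝓢.metric.causalPast 𝓢.timeOrientation (Ψ i '' (B i).truncTimeSlab ϱ τ₂)) ∧
  (∀ i (τ' : ℝ) (ϱ : ℝ → ℝ), Continuous ϱ → d.τ₀ < τ' →
      let A := Ψ i '' {x | τ' ≤ t i x.1 ∧ r i x.1 ≤ ϱ (t i x.1)}; closure A ∩ O ⊆ A) ∧
  (∀ y : d.flatDomain, d.τ₀ < y.1 0 →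
      𝓢.timeOrientation.IsFutureDirected (mfderiv 𝓘(ℝ, E4) (𝓡 4) d.flatChart y (E4.basisVector 0)))

/-- SEAMED(d, R, R₀) — copy of the `Sm` of the route decl. -/
def Sm (𝓢 : Spacetime.{0} 4) (O : Set 𝓢.carrier) (d : FinalStateDecomposition 𝓢 O 2)
    (R : Fin d.N → ℝ → ℝ) (R₀ : ℝ) : Prop :=
  let B := d.background; let t := fun i ↦ (B i).time; let r := fun i ↦ (B i).radius;
  let Λ := fun i ↦ ((d.motion i).1 : E4 ≃L[ℝ] E4); let Φ := d.flatChart; let Ψ := d.chart; let ρ := d.excision;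
  (∀ i, Monotone (R i) ∧ Continuous (R i) ∧ ∀ s, R₀ + 4 ≤ R i s ∧ R₀ ≤ ρ i s) ∧
  (∀ i, Tendsto (fun τ ↦ 𝓢.truncDeviationCk (B i) (Ψ i) 2 (R i τ) τ) atTop (𝓝 0)) ∧
  supCkENorm (Subtype.val '' {y : d.flatDomain | d.τ₀ ≤ y.1 0}) 0
      (𝓢.deviationExtend (Minkowski.backgroundOn d.flatDomain) Φ) ≤ 10⁻¹ ∧
  (∀ i, supCkENorm (Subtype.val '' {x : (B i).domain | (d.τ₀ ≤ t i x.1 ∨ d.τ₀ ≤ x.1 0) ∧ R₀ ≤ r i x.1 ∧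
      r i x.1 ≤ R i (t i x.1)}) 0 (𝓢.deviationExtend (B i) (Ψ i)) ≤
        ENNReal.ofReal (1 / (10 * ‖(Λ i : E4 →L[ℝ] E4)‖ ^ 2))) ∧
  (∀ i (x : (B i).domain), (d.τ₀ ≤ t i x.1 ∨ d.τ₀ ≤ x.1 0) → R₀ ≤ r i x.1 → r i x.1 ≤ R i (t i x.1) →
      𝓢.timeOrientation.IsFutureDirected (mfderiv 𝓘(ℝ, E4) (𝓡 4) (Ψ i) x ((Λ i) (E4.basisVector 0)))) ∧
  (∀ i (y : E4) (hy : y ∈ (B i).domain), d.τ₀ ≤ y 0 → (∀ j, ρ j (y 0) < r j y) →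
      r i y ≤ R i (t i y) + 1 → ∃ hy' : y ∈ d.flatDomain, Ψ i ⟨y, hy⟩ = Φ ⟨y, hy'⟩) ∧
  (∀ y : d.flatDomain, d.τ₀ ≤ y.1 0 → ∀ j, ρ j (y.1 0) < r j y.1) ∧
  (∀ j (y : E4), d.τ₀ ≤ y 0 → r j y ≤ ρ j (y 0) → r j y + 2 ≤ R j (t j y)) ∧
  (∀ j (y : E4), d.τ₀ ≤ t j y → r j y ≤ R j (t j y) + 2 → t j y ≤ y 0) ∧
  (∀ j, Ψ j '' {x | d.τ₀ < t j x.1 ∧ R j (t j x.1) + 1 < r j x.1} ⊆ d.radiationZone) ∧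
  (∀ τ' : ℝ, d.τ₀ < τ' → closure (Φ '' {y | τ' ≤ y.1 0}) ⊆
      Φ '' {y | τ' ≤ y.1 0} ∪ ⋃ j, Ψ j '' {x | τ' ≤ x.1 0 ∧ r j x.1 = ρ j (x.1 0)}) ∧
  (∀ j j' (y : E4), j ≠ j' → (d.τ₀ ≤ y 0 ∨ d.τ₀ ≤ t j y) → r j y ≤ R j (t j y) + 1 →
      R j' (t j' y) + 1 < r j' y)

/-! ## Card `open-late-region-first-entry` (COVER half) -/

/-- **Abstract first-entry covering lemma** (metric-free core; the LEVER of card 1). In any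
spacetime: if `F` is open, `F ⊆ C ⊆ O ⊆ I⁻(C)`, `O` is causally convex, every point of `C \ F`
and every point of `closure F ∩ O \ F` lies in `J⁻(S)`, then `O \ F ⊆ J⁻(S)`. Proof: `p ≪ q ∈ C`;
if `q ∈ F`, the first parameter of the timelike curve in `closure F` gives `q* ∈ closure F \ F`,
`q* ∈ O` by causal convexity, so `p ≤ q* ∈ J⁻(S)` and `J⁻∘J⁻ = J⁻`
(`causalFuture_causalFuture_eq`). -/
def FirstEntryCovering : Prop :=
  ∀ (𝓢 : Spacetime.{0} 4) (O C F S : Set 𝓢.carrier),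
    IsOpen F → F ⊆ C → C ⊆ O →
    O ⊆ 𝓢.metric.chronologicalPast 𝓢.timeOrientation C →
    (∀ p ∈ O, ∀ q ∈ O, 𝓢.metric.causalFuture 𝓢.timeOrientation {p} ∩
        𝓢.metric.causalPast 𝓢.timeOrientation {q} ⊆ O) →
    C \ F ⊆ 𝓢.metric.causalPast 𝓢.timeOrientation S →
    (closure F ∩ O) \ F ⊆ 𝓢.metric.causalPast 𝓢.timeOrientation S →
    O \ F ⊆ 𝓢.metric.causalPast 𝓢.timeOrientation S

/-- **Proof of the abstract first-entry lemma** (the LEVER of card 1 is a theorem, not a hope):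
infimum of the parameters mapped into the open set `F` along the timelike curve from `p` to a
late charted point; continuity puts the infimum point in `closure F`, openness keeps it out of `F`,
causal convexity keeps it in `O`, and `J⁻ ∘ J⁻ = J⁻` concludes. -/
theorem firstEntryCovering_holds : FirstEntryCovering := by
  intro 𝓢 O C F S hF _hFC hCO hOI hconv hCF hfront p hp
  obtain ⟨hpO, hpF⟩ := hp
  have hn2 : (2 : WithTop ℕ∞) ≤ ((⊤ : ℕ∞) : WithTop ℕ∞) := WithTop.coe_le_coe.mpr le_top
  -- `J⁻ ∘ J⁻ = J⁻`
  have hJJ : ∀ {x y : 𝓢.carrier}, x ∈ 𝓢.metric.causalPast 𝓢.timeOrientation {y} →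
      y ∈ 𝓢.metric.causalPast 𝓢.timeOrientation S →
      x ∈ 𝓢.metric.causalPast 𝓢.timeOrientation S := by
    intro x y hxy hyS
    have h : x ∈ 𝓢.metric.causalFuture 𝓢.timeOrientation.reverse
        (𝓢.metric.causalFuture 𝓢.timeOrientation.reverse S) :=
      LorentzianMetric.causalFuture_mono (Set.singleton_subset_iff.mpr hyS) hxy
    rw [LorentzianMetric.causalFuture_causalFuture_eq hn2] at h
    exact h
  -- `p ≪ c` for some `c ∈ C`
  have hpI : p ∈ 𝓢.metric.chronologicalFuture 𝓢.timeOrientation.reverse C := hOI hpO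
  rw [LorentzianMetric.chronologicalFuture_eq_biUnion] at hpI
  simp only [Set.mem_iUnion, exists_prop] at hpI
  obtain ⟨c, hcC, hpc⟩ := hpI
  by_cases hcF : c ∈ F
  swap
  · -- `c ∈ C \ F ⊆ J⁻ S` and `p ∈ I⁻{c} ⊆ J⁻{c}`
    exact hJJ (LorentzianMetric.chronologicalFuture_subset_causalFuture 𝓢.metric
      𝓢.timeOrientation.reverse {c} hpc) (hCF ⟨hcC, hcF⟩)
  -- the timelike curve from `p` to `c ∈ F`
  have hcp : c ∈ 𝓢.metric.chronologicalFuture 𝓢.timeOrientation {p} :=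
    LorentzianMetric.mem_chronologicalFuture_of_mem_chronologicalPast hpc
  obtain ⟨p', hp', γ, a, b, hab, hγ, hγa, hγb⟩ := hcp
  rw [Set.mem_singleton_iff] at hp'
  have hγa' : γ a = p := hγa.trans hp'
  have hγc : ∀ s ∈ Set.Icc a b, ContinuousAt γ s := fun s hs ↦ (hγ s hs).1.continuousAt
  -- first entry: infimum of the parameters mapped into `F`
  let A : Set ℝ := {s | s ∈ Set.Icc a b ∧ γ s ∈ F}
  have hbA : b ∈ A := ⟨Set.right_mem_Icc.mpr hab.le, by show γ b ∈ F; rw [hγb]; exact hcF⟩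
  have hAne : A.Nonempty := ⟨b, hbA⟩
  have hAbdd : BddBelow A := ⟨a, fun s hs ↦ hs.1.1⟩
  have hs₀b : sInf A ≤ b := csInf_le hAbdd hbA
  have has₀ : a ≤ sInf A := le_csInf hAne fun s hs ↦ hs.1.1
  have hs₀I : sInf A ∈ Set.Icc a b := ⟨has₀, hs₀b⟩
  -- `γ (sInf A) ∈ closure F`
  have hcl : γ (sInf A) ∈ closure F := by
    have h1 : sInf A ∈ closure A := csInf_mem_closure hAne hAbdd
    have h2 : γ (sInf A) ∈ closure (γ '' A) :=
      ContinuousWithinAt.mem_closure_image (hγc _ hs₀I).continuousWithinAt h1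
    refine closure_mono ?_ h2
    rintro _ ⟨s, hs, rfl⟩
    exact hs.2
  -- `γ (sInf A) ∉ F` (openness of `F`; at `a` because `p ∉ F`)
  have hnF : γ (sInf A) ∉ F := by
    intro hF₀
    have hne : a ≠ sInf A := by
      intro h
      rw [← h, hγa'] at hF₀
      exact hpF hF₀
    have has₀' : a < sInf A := lt_of_le_of_ne has₀ hne
    have hnhds : γ ⁻¹' F ∈ 𝓝 (sInf A) := (hγc _ hs₀I).preimage_mem_nhds (hF.mem_nhds hF₀)
    obtain ⟨ε, hε, hball⟩ := Metric.mem_nhds_iff.mp hnhds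
    obtain ⟨s₁, hs₁a, hs₁ε, hs₁lt⟩ : ∃ s₁, a ≤ s₁ ∧ sInf A - ε / 2 ≤ s₁ ∧ s₁ < sInf A :=
      ⟨max a (sInf A - ε / 2), le_max_left _ _, le_max_right _ _, max_lt has₀' (by linarith)⟩
    have hs₁A : s₁ ∈ A := by
      refine ⟨⟨hs₁a, hs₁lt.le.trans hs₀b⟩, ?_⟩
      apply hball
      rw [Metric.mem_ball, Real.dist_eq, abs_sub_lt_iff]
      constructor <;> linarith
    exact absurd (csInf_le hAbdd hs₁A) (not_le.mpr hs₁lt)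
  -- `p ≤ γ (sInf A)`
  have hps₀ : p ∈ 𝓢.metric.causalPast 𝓢.timeOrientation {γ (sInf A)} := by
    rcases eq_or_lt_of_le has₀ with h | h
    · rw [← h, hγa']
      exact LorentzianMetric.subset_causalPast _ _ _ (Set.mem_singleton p)
    · exact LorentzianMetric.mem_causalPast_singleton_iff.mpr (Or.inr ⟨p, Set.mem_singleton p,
        γ, a, sInf A, h, (hγ.mono (Set.Icc_subset_Icc le_rfl hs₀b)).isFutureCausalCurveOn,
        hγa', rfl⟩)
  -- `γ (sInf A) ≤ c`
  have hs₀c : γ (sInf A) ∈ 𝓢.metric.causalPast 𝓢.timeOrientation {c} := by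
    rcases eq_or_lt_of_le hs₀b with h | h
    · rw [h, hγb]
      exact LorentzianMetric.subset_causalPast _ _ _ (Set.mem_singleton c)
    · exact LorentzianMetric.mem_causalPast_singleton_iff.mpr (Or.inr ⟨γ (sInf A),
        Set.mem_singleton _, γ, sInf A, b, h,
        (hγ.mono (Set.Icc_subset_Icc has₀ le_rfl)).isFutureCausalCurveOn, rfl, hγb⟩)
  -- causal convexity: the first-entry point lies in `O`
  have hs₀O : γ (sInf A) ∈ O :=
    hconv p hpO c (hCO hcC) ⟨LorentzianMetric.mem_causalPast_singleton_iff.mp hps₀, hs₀c⟩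
  -- frontier hypothesis and `J⁻ ∘ J⁻ = J⁻`
  exact hJJ hps₀ (hfront ⟨⟨hcl, hs₀O⟩, hnF⟩)

/-- **The certified late region is open** (Key fact A): under SEAMED its lateral walls
`rⱼ = Rⱼ(tⱼ)`, `tⱼ > τ₁` are flat-late interior points (one atlas + clock lag + margin 2 +
disjointness), so `certifiedLate d R τ₁ = Φ(lateRegion τ₁) ∪ ⋃ⱼ Ψⱼ{t > τ₁, r < Rⱼ(t)}`. -/
def CertifiedLateIsOpen : Prop :=
  ∀ (𝓢 : Spacetime.{0} 4) (O : Set 𝓢.carrier) (d : FinalStateDecomposition 𝓢 O 2)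
    (R : Fin d.N → ℝ → ℝ) (R₀ : ℝ), Sm 𝓢 O d R R₀ →
    ∀ τ₁ : ℝ, d.τ₀ < τ₁ → IsOpen (certifiedLate d R τ₁)

/-- Images of open subsets of the late region under a late chart are open (the chart restricted
to the late region is an open embedding). -/
theorem isOpen_image_of_isLateChart {𝓢 : Spacetime.{0} 4} {B : ModelBackground}
    {𝒟 : Set 𝓢.carrier} {τ₀ : ℝ} {Ψ : B.domain → 𝓢.carrier} (hΨ : 𝓢.IsLateChart B 𝒟 τ₀ Ψ)
    {U : Set B.domain} (hU : IsOpen U) (hUl : U ⊆ B.lateRegion τ₀) : IsOpen (Ψ '' U) := by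
  have h := hΨ.isOpenEmbedding.isOpenMap (Subtype.val ⁻¹' U) (hU.preimage continuous_subtype_val)
  have hEq : (B.lateRegion τ₀).restrict Ψ '' (Subtype.val ⁻¹' U) = Ψ '' U := by
    ext z
    constructor
    · rintro ⟨⟨x, hxl⟩, hxU, rfl⟩
      exact ⟨x, hxU, rfl⟩
    · rintro ⟨x, hxU, rfl⟩
      exact ⟨⟨x, hUl hxU⟩, hxU, rfl⟩
  rw [← hEq]
  exact h

/-- **Proof of `CertifiedLateIsOpen`** — the single point of failure of the line is a theorem:
lateral walls `r = Rⱼ(t)`, `t > τ₁` are flat-late by one atlas (S6), whose hypotheses follow from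
clock lag (S9), margin 2 (S8) and disjointness (S12); the rest is open embeddings of open sets. -/
theorem certifiedLateIsOpen_holds : CertifiedLateIsOpen := by
  intro 𝓢 O d R R₀ hs τ₁ hτ₁
  obtain ⟨hS1, -, -, -, -, hS6, -, hS8, hS9, -, -, hS12⟩ := hs
  -- continuity of the clocks and radii
  have hc0 : Continuous fun y : E4 ↦ y 0 := PiLp.continuous_apply 2 _ 0
  have ht : ∀ i, Continuous fun x : E4 ↦ (d.background i).time x := fun i ↦
    hc0.comp (continuous_poincareInv _ _)
  have hr : ∀ i, Continuous fun x : E4 ↦ (d.background i).radius x := fun i ↦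
    (Kerr.continuous_radius _).comp (continuous_poincareInv _ _)
  -- the open pieces
  have hF₀ : IsOpen (d.flatChart '' (Minkowski.backgroundOn d.flatDomain).lateRegion τ₁) := by
    refine isOpen_image_of_isLateChart d.isLateChart_flat ?_ fun y hy ↦ lt_trans hτ₁ hy
    exact isOpen_lt continuous_const (hc0.comp continuous_subtype_val)
  have hFi : ∀ i, IsOpen (d.chart i '' {x | τ₁ < (d.background i).time x.1 ∧
      (d.background i).radius x.1 < R i ((d.background i).time x.1)}) := by
    intro i
    refine isOpen_image_of_isLateChart (d.isLateChart i) ?_ fun x hx ↦ lt_trans hτ₁ hx.1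
    exact (isOpen_lt continuous_const ((ht i).comp continuous_subtype_val)).and
      (isOpen_lt ((hr i).comp continuous_subtype_val)
        ((hS1 i).2.1.comp ((ht i).comp continuous_subtype_val)))
  -- `certifiedLate` is the union of the open pieces: lateral walls are flat-late
  have hEq : certifiedLate d R τ₁ =
      d.flatChart '' (Minkowski.backgroundOn d.flatDomain).lateRegion τ₁ ∪
        ⋃ i, d.chart i '' {x | τ₁ < (d.background i).time x.1 ∧
          (d.background i).radius x.1 < R i ((d.background i).time x.1)} := by
    refine Set.Subset.antisymm ?_ ?_
    · rintro z (hz | hz)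
      · exact Or.inl hz
      · obtain ⟨j, x, ⟨hxt, hxr⟩, rfl⟩ := Set.mem_iUnion.mp hz
        rcases lt_or_eq_of_le hxr with hlt | heq
        · exact Or.inr (Set.mem_iUnion.mpr ⟨j, x, ⟨hxt, hlt⟩, rfl⟩)
        · -- lateral wall point
          left
          have hτ₀t : d.τ₀ ≤ (d.background j).time x.1 := (lt_trans hτ₁ hxt).le
          have hlag : (d.background j).time x.1 ≤ x.1 0 := hS9 j x.1 hτ₀t (by linarith)
          have hτ₀y : d.τ₀ ≤ x.1 0 := by linarith
          have hout : ∀ k, d.excision k (x.1 0) < (d.background k).radius x.1 := by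
            intro k
            by_contra hk
            push Not at hk
            have h8 : (d.background k).radius x.1 + 2 ≤ R k ((d.background k).time x.1) :=
              hS8 k x.1 hτ₀y hk
            rcases eq_or_ne k j with rfl | hkj
            · linarith
            · have h12 : R k ((d.background k).time x.1) + 1 < (d.background k).radius x.1 :=
                hS12 j k x.1 (Ne.symm hkj) (Or.inl hτ₀y) (by linarith)
              linarith
          obtain ⟨hy', hEqΦ⟩ := hS6 j x.1 x.2 hτ₀y hout (by linarith)
          refine ⟨⟨x.1, hy'⟩, ?_, ?_⟩
          · show τ₁ < x.1 0
            linarith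
          · rw [← hEqΦ]
    · rintro z (hz | hz)
      · exact Or.inl hz
      · obtain ⟨j, x, ⟨hxt, hxr⟩, rfl⟩ := Set.mem_iUnion.mp hz
        exact Or.inr (Set.mem_iUnion.mpr ⟨j, x, ⟨hxt, hxr.le⟩, rfl⟩)
  rw [hEq]
  exact hF₀.union (isOpen_iUnion hFi)

/-- **Frontier control** (Key fact B): the frontier of the certified late region inside `O`
lies in the causal past of the certified slab — flat closure clause S11, tube closedness Hc(c)
with `ϱ = Rⱼ`, and one co-moving `Λⱼe₀`-segment for early flat-tube-wall points. -/
def FrontierBelowSlab : Prop :=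
  ∀ (𝓢 : Spacetime.{0} 4) (O : Set 𝓢.carrier) (d : FinalStateDecomposition 𝓢 O 2)
    (R : Fin d.N → ℝ → ℝ) (R₀ : ℝ), Hc 𝓢 O 2 d R₀ → Sm 𝓢 O d R R₀ →
    ∀ τ₁ : ℝ, d.τ₀ < τ₁ →
      (closure (certifiedLate d R τ₁) ∩ O) \ certifiedLate d R τ₁ ⊆
        𝓢.metric.causalPast 𝓢.timeOrientation (certifiedSlab d R τ₁)

/-! ## Card `anchor-and-board` (REACH half) -/

/-- **Charted reach** (Key fact C): every charted point outside the certified late region lies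
in the causal past of the certified slab — hole points by ANCHORING Hc(b) at radius `Rⱼ(τ₁)`
(flow-free), far leaves / collars reduce to flat points (S10 / one atlas), flat points by the
`e₀`-ray up to FIRST CONTACT with the closed certified tubes `{rₖ ≤ Rₖ(tₖ)}` and then the
co-moving `Λₖe₀`-ride (S5), never touching a flat-tube wall. -/
def ChartedReach : Prop :=
  ∀ (𝓢 : Spacetime.{0} 4) (O : Set 𝓢.carrier) (d : FinalStateDecomposition 𝓢 O 2)
    (R : Fin d.N → ℝ → ℝ) (R₀ : ℝ), Hc 𝓢 O 2 d R₀ → Sm 𝓢 O d R R₀ →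
    ∀ τ₁ : ℝ, d.τ₀ < τ₁ →
      d.charted \ certifiedLate d R τ₁ ⊆
        𝓢.metric.causalPast 𝓢.timeOrientation (certifiedSlab d R τ₁)

/-- **Boarding lemma** (the LEVER of card 2, flat case of `ChartedReach`): a flat-late point
with flat time in `(τ₀, τ₁]` lies in `J⁻` of the certified slab at `τ₁`. -/
def FlatBoarding : Prop :=
  ∀ (𝓢 : Spacetime.{0} 4) (O : Set 𝓢.carrier) (d : FinalStateDecomposition 𝓢 O 2)
    (R : Fin d.N → ℝ → ℝ) (R₀ : ℝ), Hc 𝓢 O 2 d R₀ → Sm 𝓢 O d R R₀ →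
    ∀ τ₁ : ℝ, d.τ₀ < τ₁ → ∀ y : d.flatDomain, d.τ₀ < y.1 0 → y.1 0 ≤ τ₁ →
      d.flatChart y ∈ 𝓢.metric.causalPast 𝓢.timeOrientation (certifiedSlab d R τ₁)

/-- **Hole anchoring at the slab radius** (flow-free part of card 2): a hole-charted point with
hole time in `(τ₀, τ₁)` and radius `< Rⱼ(τ₁)` lies in `J⁻` of the certified slab — Hc(b) with
`ϱ = Rⱼ(τ₁) ≥ R₀`, `τ₂ = τ₁`. -/
def HoleAnchoring : Prop :=
  ∀ (𝓢 : Spacetime.{0} 4) (O : Set 𝓢.carrier) (d : FinalStateDecomposition 𝓢 O 2)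
    (R : Fin d.N → ℝ → ℝ) (R₀ : ℝ), Hc 𝓢 O 2 d R₀ → Sm 𝓢 O d R R₀ →
    ∀ τ₁ : ℝ, d.τ₀ < τ₁ → ∀ (j : Fin d.N) (x : (d.background j).domain),
      d.τ₀ < (d.background j).time x.1 → (d.background j).time x.1 < τ₁ →
      (d.background j).radius x.1 < R j τ₁ →
      d.chart j x ∈ 𝓢.metric.causalPast 𝓢.timeOrientation (certifiedSlab d R τ₁)

/-- `HoleAnchoring` is Hc(b) at radius `Rⱼ(τ₁)` plus monotonicity of `J⁻` — proved here as a
check that the anchoring clause composes with `certifiedSlab` exactly as card 2 claims. -/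
theorem holeAnchoring_holds : HoleAnchoring := by
  intro 𝓢 O d R R₀ hc hs τ₁ hτ₁ j x ht₀ ht₁ hr
  obtain ⟨-, hanchor, -, -⟩ := hc
  obtain ⟨hrad, -⟩ := hs
  have hR₀ : R₀ ≤ R j τ₁ := by linarith [((hrad j).2.2 τ₁).1]
  have hx : d.chart j x ∈ d.chart j '' {x | d.τ₀ < (d.background j).time x.1 ∧
      (d.background j).time x.1 < τ₁ ∧ (d.background j).radius x.1 < R j τ₁} :=
    ⟨x, ⟨ht₀, ht₁, hr⟩, rfl⟩
  have h1 := hanchor j (R j τ₁) τ₁ hR₀ hτ₁ hx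
  refine LorentzianMetric.causalFuture_mono ?_ h1
  intro z hz
  exact Set.mem_union_right _ (Set.mem_iUnion.mpr ⟨j, hz⟩)

/-! ## Shared support signature (both cards): the co-moving ride on a certified tube -/

/-- **Tube ride**: a point of hole chart `j` on the certified tube `R₀ ≤ r ≤ Rⱼ(t)` (flat-late or
hole-late) with hole time `≤ τ₁` lies in `J⁻` of the certified slab at `τ₁` — the `Λⱼe₀`-segment at
constant rest-frame radius is future causal by S5 (monotone `R`, orthochronous `Λⱼ`) and ends on
`truncTimeSlab (Rⱼ τ₁) τ₁`. Used by `FrontierBelowSlab` (flat-tube walls, where S8 gives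
`r + 2 ≤ R(t)`) and by `FlatBoarding` (after first contact). -/
def TubeRide : Prop :=
  ∀ (𝓢 : Spacetime.{0} 4) (O : Set 𝓢.carrier) (d : FinalStateDecomposition 𝓢 O 2)
    (R : Fin d.N → ℝ → ℝ) (R₀ : ℝ), Hc 𝓢 O 2 d R₀ → Sm 𝓢 O d R R₀ →
    ∀ τ₁ : ℝ, d.τ₀ < τ₁ → ∀ (j : Fin d.N) (x : (d.background j).domain),
      (d.τ₀ ≤ (d.background j).time x.1 ∨ d.τ₀ ≤ x.1 0) → R₀ ≤ (d.background j).radius x.1 →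
      (d.background j).radius x.1 ≤ R j ((d.background j).time x.1) →
      (d.background j).time x.1 ≤ τ₁ →
      d.chart j x ∈ 𝓢.metric.causalPast 𝓢.timeOrientation (certifiedSlab d R τ₁)

/-! ## Sanity: the copies `Hc`/`Sm` are syntactically the route's let-bound predicates -/

/-- The crux restated with the named copies `Hc`, `Sm` is definitionally the route decl. -/
theorem seamedChartsExhaust_iff :
    Summit.FinalStateConjecture.FinalStateConjecture.Theses.StarvedNecks.SeamedChartsExhaust ↔
    (∀ (X : Type) [TopologicalSpace X] [ChartedSpace E3 X] [IsManifold (𝓡 3) ∞ X]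
      [ConnectedSpace X] (D : InitialDataSet (𝓡 3) X), D ∈ admissibleVacuumData X →
      ∀ 𝒟 : VacuumCauchyDevelopment D, 𝒟.IsMaximal →
      ∀ (O : Set 𝒟.carrier) (d : FinalStateDecomposition 𝒟.toSpacetime O 2)
        (R : Fin d.N → ℝ → ℝ) (R₀ : ℝ), O = exteriorOf 𝒟.toCauchyDevelopment d.charted →
        Hc 𝒟.toSpacetime O 2 d R₀ → Sm 𝒟.toSpacetime O d R R₀ → HasExhaustiveCharts d) :=
  Iff.rfl

/-! ## How the halves compose (statement only; the skeleton is crux-plan's job) -/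

/-- The two cards together with the abstract lemma decide the crux. -/
def LineCloses : Prop :=
  FirstEntryCovering → CertifiedLateIsOpen → FrontierBelowSlab → ChartedReach →
    Summit.FinalStateConjecture.FinalStateConjecture.Theses.StarvedNecks.SeamedChartsExhaust

/-- The only two properties of `O = exteriorOf 𝒟 U = J⁺(ι X) ∩ I⁻(U)` the line uses:
`O ⊆ I⁻(U)` and causal convexity `J⁺(p) ∩ J⁻(q) ⊆ O` for `p, q ∈ O` (transitivity of `J⁺`,
`causalFuture_causalFuture_eq`; push-up `x ≤ q ≪ c ⇒ x ≪ c`,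
`mem_chronologicalFuture_of_mem_causalFuture`; time duality). -/
theorem exteriorOf_causallyConvex {X : Type} [TopologicalSpace X] [ChartedSpace E3 X]
    [IsManifold (𝓡 3) ∞ X] [ConnectedSpace X] {D : InitialDataSet (𝓡 3) X}
    (𝒟 : VacuumCauchyDevelopment D) (U : Set 𝒟.carrier) :
    (exteriorOf 𝒟.toCauchyDevelopment U ⊆
        𝒟.toSpacetime.metric.chronologicalPast 𝒟.toSpacetime.timeOrientation U) ∧
    ∀ p ∈ exteriorOf 𝒟.toCauchyDevelopment U, ∀ q ∈ exteriorOf 𝒟.toCauchyDevelopment U,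
      𝒟.toSpacetime.metric.causalFuture 𝒟.toSpacetime.timeOrientation {p} ∩
          𝒟.toSpacetime.metric.causalPast 𝒟.toSpacetime.timeOrientation {q} ⊆
        exteriorOf 𝒟.toCauchyDevelopment U := by
  refine ⟨Set.inter_subset_right, ?_⟩
  rintro p ⟨hpS, -⟩ q ⟨-, hqU⟩ x ⟨hxp, hxq⟩
  have hn2 : (2 : WithTop ℕ∞) ≤ ((⊤ : ℕ∞) : WithTop ℕ∞) := WithTop.coe_le_coe.mpr le_top
  have hn1 : (1 : WithTop ℕ∞) ≤ ((⊤ : ℕ∞) : WithTop ℕ∞) := WithTop.coe_le_coe.mpr le_top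
  refine ⟨?_, ?_⟩
  · -- `x ∈ J⁺(ι X)` : `J⁺(J⁺ S) = J⁺ S`
    have hx : x ∈ 𝒟.toSpacetime.metric.causalFuture 𝒟.toSpacetime.timeOrientation
        (𝒟.toSpacetime.metric.causalFuture 𝒟.toSpacetime.timeOrientation (range 𝒟.embed)) :=
      LorentzianMetric.causalFuture_mono (Set.singleton_subset_iff.mpr hpS) hxp
    rwa [LorentzianMetric.causalFuture_causalFuture_eq hn2] at hx
  · -- `x ∈ I⁻(U)` : `q ≪⁻ c ∈ U`, `x ≤ q ≪ c ⇒ x ≪ c`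
    have hqU' : q ∈ 𝒟.toSpacetime.metric.chronologicalFuture
        𝒟.toSpacetime.timeOrientation.reverse U := hqU
    rw [LorentzianMetric.chronologicalFuture_eq_biUnion] at hqU'
    simp only [Set.mem_iUnion, exists_prop] at hqU'
    obtain ⟨c, hcU, hqc⟩ := hqU'
    have hcq : c ∈ 𝒟.toSpacetime.metric.chronologicalFuture 𝒟.toSpacetime.timeOrientation {q} :=
      LorentzianMetric.mem_chronologicalFuture_of_mem_chronologicalPast hqc
    have hqx : q ∈ 𝒟.toSpacetime.metric.causalFuture 𝒟.toSpacetime.timeOrientation {x} :=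
      LorentzianMetric.mem_causalPast_singleton_iff.mp hxq
    have hcx : c ∈ 𝒟.toSpacetime.metric.chronologicalFuture 𝒟.toSpacetime.timeOrientation {x} :=
      LorentzianMetric.mem_chronologicalFuture_of_mem_causalFuture hn1 hqx hcq
    have hxc := LorentzianMetric.mem_chronologicalPast_of_mem_chronologicalFuture hcx
    show x ∈ 𝒟.toSpacetime.metric.chronologicalFuture 𝒟.toSpacetime.timeOrientation.reverse U
    rw [LorentzianMetric.chronologicalFuture_eq_biUnion]
    simp only [Set.mem_iUnion, exists_prop]
    exact ⟨c, hcU, hxc⟩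

/-- **The decomposition concludes the crux by name** (sorry-free reduction): the abstract
first-entry lemma, openness of the certified late region, frontier control and charted reach
imply `StarvedNecks.SeamedChartsExhaust`. -/
theorem lineCloses_holds : LineCloses := by
  intro hFE hOpen hFront hReach X _ _ _ _ D hD 𝒟 h𝒟 O d R R₀ hO hc hs
  refine ⟨R, hs.2.1, fun τ₁ hτ₁ ↦ ?_⟩
  obtain ⟨hOI, hconv⟩ := exteriorOf_causallyConvex 𝒟 d.charted
  rw [← hO] at hOI hconv
  refine hFE 𝒟.toSpacetime O d.charted (certifiedLate d R τ₁) (certifiedSlab d R τ₁)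
    (hOpen _ O d R R₀ hs τ₁ hτ₁) ?_ d.charted_subset hOI hconv
    (hReach _ O d R R₀ hc hs τ₁ hτ₁) (hFront _ O d R R₀ hc hs τ₁ hτ₁)
  -- `certifiedLate ⊆ charted`
  rintro z (⟨y, hy, rfl⟩ | hz)
  · exact d.radiationZone_subset_charted ⟨y, lt_trans hτ₁ hy, rfl⟩
  · obtain ⟨i, x, hx, rfl⟩ := Set.mem_iUnion.mp hz
    exact d.region_subset_charted i ⟨x, lt_trans hτ₁ hx.1, rfl⟩

/-- **Net reduction (sorry-free)**: the crux `StarvedNecks.SeamedChartsExhaust` follows from the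
three chart-bookkeeping statements alone — openness of the certified late region (card 1),
frontier control (card 1) and charted reach (card 2); the causal-topological glue
(`firstEntryCovering_holds`, `exteriorOf_causallyConvex`, `lineCloses_holds`) is proved above. -/
theorem seamedChartsExhaust_of (h₁ : CertifiedLateIsOpen) (h₂ : FrontierBelowSlab)
    (h₃ : ChartedReach) :
    Summit.FinalStateConjecture.FinalStateConjecture.Theses.StarvedNecks.SeamedChartsExhaust :=
  lineCloses_holds firstEntryCovering_holds h₁ h₂ h₃

/-- **Net reduction after the bonus proof of `CertifiedLateIsOpen`**: the crux follows from the TWO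
remaining chart-bookkeeping statements `FrontierBelowSlab` (card 1) and `ChartedReach` (card 2). -/
theorem seamedChartsExhaust_of₂ (h₂ : FrontierBelowSlab) (h₃ : ChartedReach) :
    Summit.FinalStateConjecture.FinalStateConjecture.Theses.StarvedNecks.SeamedChartsExhaust :=
  seamedChartsExhaust_of certifiedLateIsOpen_holds h₂ h₃

end Summit.FinalStateConjecture.FinalStateConjecture.Cruxes.SeamedChartsExhaust.Sketch3

end
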